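import Summits.KontsevichZagierPeriods.KontsevichZagierPeriods.Theorems.LinRedNormalFormArrangementNormalFormSeparateTwoZeroChart
import Summits.KontsevichZagierPeriods.KontsevichZagierPeriods.Theorems.LinRedNormalFormArrangementNormalFormSeparateTwoZeroCandidates

/-!
# Letters, special points and the closed cell

(Line `janus-bands`, crux `ArrangementNormalForm`, stub `stub_separateTwoZero` — separation in a
good rational direction for PLANAR arrangement representations without fibres; part `Letters`.)

Dictionary between the engine's `y`-letters `root 1 c` (slope, intercept) and full-base forms
(`near_iff`, `evq_eq_mul`), crossing points and walls of pairs of letters (`exists_cross`,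
registered as `separateTwoZero_letters`; `wall_of_near`), rational points of the closed cell
(`rows_nonneg_of_mem_closure`, `not_both_mem_closure`), the double cone at a special point from two
rows (`cone_of_rows`) and the harmlessness of walls through far special points
(`fst_sub_bounded_below`).
-/

noncomputable section

open Set MeasureTheory Filter Topology
open scoped ENNReal

namespace Summit.KontsevichZagierPeriods.ArrangementNormalForm.JanusBands

open Literature.NumberTheory.Transcendental

namespace SepTwoZero

open SeparatePos MvPolynomial

section Piece



/-- A rational point of the base plane as a real point. -/
def rpt (X : ℚ × ℚ) : Fin (1 + 1 + 0) → ℝ := ![(X.1 : ℝ), (X.2 : ℝ)]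

/-- First coordinate of a rational point. -/
@[simp] theorem rpt_zero (X : ℚ × ℚ) : rpt X 0 = X.1 := rfl
/-- Second coordinate of a rational point. -/
@[simp] theorem rpt_one (X : ℚ × ℚ) : rpt X 1 = X.2 := rfl

/-- A row at a rational point. -/
theorem rowval_rpt (c : (Fin (1 + 1) → ℚ) × ℚ) (X : ℚ × ℚ) :
    ∑ i, (c.1 i : ℝ) * rpt X (Fin.castAdd 0 i) + c.2 = (evq c X : ℝ) := by
  rw [rowval_eq]; simp [evq]

/-- A row through a rational point, recentred there. -/
theorem rowval_sub_rpt (c : (Fin (1 + 1) → ℚ) × ℚ) (X : ℚ × ℚ) (hX : evq c X = 0)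
    (z : Fin (1 + 1 + 0) → ℝ) : ∑ i, (c.1 i : ℝ) * z (Fin.castAdd 0 i) + c.2 =
      (c.1 0 : ℝ) * (z 0 - X.1) + (c.1 1 : ℝ) * (z 1 - X.2) := by
  have h : ((c.1 0 : ℝ) * X.1 + c.1 1 * X.2 + c.2) = 0 := by exact_mod_cast hX
  rw [rowval_eq]; linear_combination h

variable {m' : ℕ} (M : Fin m' → (Fin (1 + 1) → ℚ) × ℚ)
  (lo up : Fin 0 → Fin 0 ⊕ ((Fin (1 + 1) → ℚ) × ℚ))

/-- Points of the closed cell satisfy the weak row inequalities. -/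
theorem rows_nonneg_of_mem_closure {z : Fin (1 + 1 + 0) → ℝ}
    (hz : z ∈ closure (gDom 1 0 m' M lo up)) (j : Fin m') :
    0 ≤ ∑ i, ((M j).1 i : ℝ) * z (Fin.castAdd 0 i) + (M j).2 := by
  refine le_of_mem_closure' (f := fun _ => (0 : ℝ))
    (g := fun z : Fin (1 + 1 + 0) → ℝ => ∑ i, ((M j).1 i : ℝ) * z (Fin.castAdd 0 i) + (M j).2)
    continuous_const (by simp only [rowval_eq]; fun_prop) (fun z hz => (hz.1 j).le) hz

/-- **Separation of the special points**: two points of `𝒳` separated by a row are not both in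
the closed cell. -/
theorem not_both_mem_closure {X X' : ℚ × ℚ} (j : Fin m') (hj : evq (M j) X * evq (M j) X' < 0)
    (hX : rpt X ∈ closure (gDom 1 0 m' M lo up)) (hX' : rpt X' ∈ closure (gDom 1 0 m' M lo up)) :
    False := by
  have h1 := rows_nonneg_of_mem_closure M lo up hX j
  have h2 := rows_nonneg_of_mem_closure M lo up hX' j
  rw [rowval_rpt] at h1 h2
  have : (0 : ℝ) ≤ (evq (M j) X : ℝ) * (evq (M j) X' : ℝ) := mul_nonneg h1 h2
  have h3 : ((evq (M j) X * evq (M j) X' : ℚ) : ℝ) < 0 := by exact_mod_cast hj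
  push_cast at h3; linarith

/-- **The double cone at a special point** from two rows through it with `y`-coefficients of
opposite signs: the cell lies in `{a₁ (x − X₁) < y − X₂ < b₁ (x − X₁)}`. -/
theorem cone_of_rows {X : ℚ × ℚ} {j j' : Fin m'} (hj : evq (M j) X = 0) (hj' : evq (M j') X = 0)
    (hβ : (M j).1 1 < 0) (hβ' : 0 < (M j').1 1) :
    ∀ z ∈ gDom 1 0 m' M lo up,
      ((-(M j').1 0 / (M j').1 1 : ℚ) : ℝ) * (z 0 - X.1) < z 1 - X.2 ∧
        z 1 - X.2 < ((-(M j).1 0 / (M j).1 1 : ℚ) : ℝ) * (z 0 - X.1) := by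
  intro z hz
  have h1 := hz.1 j
  have h2 := hz.1 j'
  rw [rowval_sub_rpt (M j) X hj] at h1
  rw [rowval_sub_rpt (M j') X hj'] at h2
  have hb : ((M j).1 1 : ℝ) < 0 := by exact_mod_cast hβ
  have hb' : (0 : ℝ) < (M j').1 1 := by exact_mod_cast hβ'
  push_cast
  constructor
  · rw [div_mul_eq_mul_div, div_lt_iff₀ hb']; nlinarith
  · rw [div_mul_eq_mul_div, lt_div_iff_of_neg hb]; nlinarith

/-- The only point of the closed cell on the wall `x = X₁` through a special point is the
point itself. -/
theorem eq_of_mem_closure_of_fst_eq {X : ℚ × ℚ} {j j' : Fin m'} (hj : evq (M j) X = 0)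
    (hj' : evq (M j') X = 0) (hβ : (M j).1 1 < 0) (hβ' : 0 < (M j').1 1)
    {z : Fin (1 + 1 + 0) → ℝ} (hz : z ∈ closure (gDom 1 0 m' M lo up)) (hx : z 0 = X.1) :
    z = rpt X := by
  have h1 := rows_nonneg_of_mem_closure M lo up hz j
  have h2 := rows_nonneg_of_mem_closure M lo up hz j'
  rw [rowval_sub_rpt (M j) X hj, hx, sub_self, mul_zero, zero_add] at h1
  rw [rowval_sub_rpt (M j') X hj', hx, sub_self, mul_zero, zero_add] at h2
  have hb : ((M j).1 1 : ℝ) < 0 := by exact_mod_cast hβ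
  have hb' : (0 : ℝ) < (M j').1 1 := by exact_mod_cast hβ'
  have hy : z 1 = X.2 := by nlinarith
  ext k; fin_cases k
  · exact hx
  · exact hy

/-- **Harmless walls through far special points**: if `X` is a special point (double cone)
outside the closed bounded cell, then `|x − X₁|` is bounded below on the cell. -/
theorem fst_sub_bounded_below {X : ℚ × ℚ} {j j' : Fin m'} (hj : evq (M j) X = 0)
    (hj' : evq (M j') X = 0) (hβ : (M j).1 1 < 0) (hβ' : 0 < (M j').1 1)
    (hbd : Bornology.IsBounded (gDom 1 0 m' M lo up))
    (hX : rpt X ∉ closure (gDom 1 0 m' M lo up)) :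
    ∃ c₀ > 0, ∀ z ∈ gDom 1 0 m' M lo up, c₀ ≤ |z 0 - X.1| := by
  by_cases hne : (closure (gDom 1 0 m' M lo up)).Nonempty
  · obtain ⟨z₀, hz₀, hmin⟩ := hbd.isCompact_closure.exists_isMinOn hne
      (f := fun z : Fin (1 + 1 + 0) → ℝ => |z 0 - X.1|) (by fun_prop)
    have hpos : 0 < |z₀ 0 - X.1| := by
      rw [abs_pos, sub_ne_zero]
      intro h
      exact hX (eq_of_mem_closure_of_fst_eq M lo up hj hj' hβ hβ' hz₀ h ▸ hz₀)
    exact ⟨_, hpos, fun z hz => hmin (subset_closure hz)⟩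
  · refine ⟨1, one_pos, fun z hz => absurd ⟨z, subset_closure hz⟩ hne⟩

end Piece

section Letters

/-- Slope and intercept of a `y`-letter: `root 1 c = (−c₀/c₁, −c₂/c₁)`. -/
theorem root_fst (c : (Fin (1 + 1) → ℚ) × ℚ) : (root 1 c).1 0 = -c.1 0 / c.1 1 := rfl

/-- The intercept of a `y`-letter. -/
theorem root_snd (c : (Fin (1 + 1) → ℚ) × ℚ) : (root 1 c).2 = -c.2 / c.1 1 := rfl

/-- Letters are determined by slope and intercept. -/
theorem root_eq_iff (c c' : (Fin (1 + 1) → ℚ) × ℚ) :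
    root 1 c = root 1 c' ↔ (root 1 c).1 0 = (root 1 c').1 0 ∧ (root 1 c).2 = (root 1 c').2 := by
  constructor
  · intro h; rw [h]; exact ⟨rfl, rfl⟩
  · rintro ⟨h1, h2⟩
    exact Prod.ext (funext fun i => by fin_cases i; exact h1) h2

/-- A letter passes through `V` iff its form vanishes at `V`. -/
theorem near_iff {c : (Fin (1 + 1) → ℚ) × ℚ} (hc : c.1 1 ≠ 0) (V : ℚ × ℚ) :
    (root 1 c).1 0 * V.1 + (root 1 c).2 = V.2 ↔ evq c V = 0 := by
  rw [root_fst, root_snd, evq]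
  constructor
  · intro h; field_simp at h; linarith
  · intro h; field_simp; linarith

/-- The letter's form factors through its root: `c(x, y) = c₁ (y − λ(x))`. -/
theorem evq_eq_mul {c : (Fin (1 + 1) → ℚ) × ℚ} (hc : c.1 1 ≠ 0) (X : ℚ × ℚ) :
    evq c X = c.1 1 * (X.2 - ((root 1 c).1 0 * X.1 + (root 1 c).2)) := by
  rw [root_fst, root_snd, evq]; field_simp; ring

/-- The crossing point of two non-parallel `y`-letters, and the wall through it. -/
theorem exists_cross {c c' : (Fin (1 + 1) → ℚ) × ℚ} (hc : c.1 1 ≠ 0) (hc' : c'.1 1 ≠ 0)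
    (hs : (root 1 c).1 0 ≠ (root 1 c').1 0) :
    ∃ X : ℚ × ℚ, evq c X = 0 ∧ evq c' X = 0 ∧ c.1 0 * c'.1 1 ≠ c.1 1 * c'.1 0 ∧
      ∀ z : Fin (1 + 1 + 0) → ℝ, affB 1 0 (root 1 c - root 1 c') z =
        (((root 1 c).1 0 - (root 1 c').1 0 : ℚ) : ℝ) * (z 0 - X.1) := by
  set s := (root 1 c).1 0 with hsd
  set s' := (root 1 c').1 0 with hsd'
  set t := (root 1 c).2 with htd
  set t' := (root 1 c').2 with htd'
  have hss : s - s' ≠ 0 := sub_ne_zero.2 hs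
  set x := (t' - t) / (s - s') with hx
  refine ⟨(x, s * x + t), ?_, ?_, ?_, fun z => ?_⟩
  · rw [evq_eq_mul hc]; simp [← hsd, ← htd]
  · rw [evq_eq_mul hc']
    simp only [← hsd', ← htd']
    have : s * x + t - (s' * x + t') = 0 := by
      rw [show s * x + t - (s' * x + t') = (s - s') * x - (t' - t) by ring, hx]
      field_simp; ring
    rw [this, mul_zero]
  · intro h
    apply hs
    rw [hsd, hsd', root_fst, root_fst, div_eq_div_iff hc hc']
    linarith
  · rw [affB_sub, affB_eq, affB_eq]
    try simp only [← hsd, ← hsd', ← htd, ← htd']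
    have hx' : (s - s') * x = t' - t := by rw [hx]; field_simp
    have : ((t : ℝ) - t') = -(((s : ℝ) - s') * x) := by
      rw [show ((s : ℝ) - s') * x = ((((s - s') * x : ℚ)) : ℝ) by push_cast; ring, hx']
      push_cast; ring
    push_cast
    linear_combination this

/-- Two distinct letters through `V`: different slopes, and the wall is `(s − s')(x − V₁)`. -/
theorem wall_of_near {c c' : (Fin (1 + 1) → ℚ) × ℚ} {V : ℚ × ℚ}
    (hn : (root 1 c).1 0 * V.1 + (root 1 c).2 = V.2)
    (hn' : (root 1 c').1 0 * V.1 + (root 1 c').2 = V.2) (hne : root 1 c ≠ root 1 c') :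
    (root 1 c).1 0 ≠ (root 1 c').1 0 ∧
      ∀ z : Fin (1 + 1 + 0) → ℝ, affB 1 0 (root 1 c - root 1 c') z =
        (((root 1 c).1 0 - (root 1 c').1 0 : ℚ) : ℝ) * (z 0 - V.1) := by
  have hs : (root 1 c).1 0 ≠ (root 1 c').1 0 := by
    intro h
    apply hne
    rw [root_eq_iff]
    refine ⟨h, ?_⟩
    rw [h] at hn; linarith
  refine ⟨hs, fun z => ?_⟩
  rw [affB_sub, affB_eq, affB_eq]
  have h2 : ((root 1 c).2 : ℝ) - (root 1 c').2 = -((((root 1 c).1 0 : ℝ) - (root 1 c').1 0) * V.1) := by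
    have : (root 1 c).2 - (root 1 c').2 = -(((root 1 c).1 0 - (root 1 c').1 0) * V.1) := by linarith
    exact_mod_cast this
  push_cast
  linear_combination h2

end Letters

end SepTwoZero

open SepTwoZero SeparatePos in
/-- **Crossing point and wall of two non-parallel letters** (registered sub-goal of `stub_separateTwoZero`). -/
theorem separateTwoZero_letters {c c' : (Fin (1 + 1) → ℚ) × ℚ} (hc : c.1 1 ≠ 0) (hc' : c'.1 1 ≠ 0) (hs : (SeparatePos.root 1 c).1 0 ≠ (SeparatePos.root 1 c').1 0) : ∃ X : ℚ × ℚ, SepTwoZero.evq c X = 0 ∧ SepTwoZero.evq c' X = 0 ∧ c.1 0 * c'.1 1 ≠ c.1 1 * c'.1 0 ∧ ∀ z : Fin (1 + 1 + 0) → ℝ, SeparatePos.affB 1 0 (SeparatePos.root 1 c - SeparatePos.root 1 c') z = (((SeparatePos.root 1 c).1 0 - (SeparatePos.root 1 c').1 0 : ℚ) : ℝ) * (z 0 - X.1) := by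
  exact exists_cross hc hc' hs

end Summit.KontsevichZagierPeriods.ArrangementNormalForm.JanusBands
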